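import Literature.AlgebraicGeometry.Resolution.KollarNmPartBlowup
import Literature.AlgebraicGeometry.Resolution.RegularSubschemeLocallyIrreducible
import Literature.AlgebraicGeometry.Resolution.ComponentGluing
import HarnessLib

/-!
# The components of a regular centre: a regular closed subscheme of a Noetherian scheme is the disjoint union of
# its (finitely many) irreducible components, and its ideal sheaf is the product of their (pairwise comaximal) ideals

Topic: `Literature/AlgebraicGeometry/Resolution`. Kernel support («F2») for the re-sequencing of a blow-up along a
regular but REDUCIBLE centre `V(C)` into the successive blow-ups along its irreducible (= connected) components
(Stacks 080A `IsBlowup.comp`, `BlowupsProduct.lean`), as needed to turn the tree's resolution of marked monomial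
ideals (`exists_isResolutionOf_monomialMarked`, Kollár 2007 (3.111) Step 3, whose centres are the strata
`E^{j_1} ∩ ⋯ ∩ E^{j_r}` — regular, possibly disconnected) into a blow-up sequence with IRREDUCIBLE regular centres
(Bierstone–Grigoriev–Milman–Włodarczyk 2011, §4 Step 2b: "we can randomly pick any maximal irreducible component of
`supp(𝓘, μ)`"; Hironaka's permissible centres, §2.1 of the 2017 manuscript, are irreducible by definition).

For `X` locally Noetherian with Noetherian underlying space and `C : X.IdealSheafData` with `V(C)` a regular scheme
(`Scheme.IsRegular C.subscheme`):

* `isPiecePartition_boundaryPieces_of_isRegular` — the irreducible components of `V(C)` (the list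
  `Kollar2007.boundaryPieces C` of `KollarSplitBoundary.lean`) are pairwise DISJOINT and cover `V(C)` (regular local
  rings are domains, `Scheme.IsRegular.eq_of_mem_irreducibleComponents`); they are irreducible, non-empty, closed
  (`isIrreducible_of_mem_boundaryPieces`), and there are none iff `C = ⊤` (`boundaryPieces_eq_nil_iff`);
and, for ANY partition `Zs` of `V(C)` into pairwise disjoint closed pieces (`IsPiecePartition C Zs`,
`BoundarySplitting.lean`):
* (`C` is radical, `𝓘(V(C)) = C`: tree `eq_vanishingIdeal_support_of_isRegular`, `RegularSubschemeLocallyIrreducible.lean`)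
  `iInf_pieceIdeals_eq_of_isRegular`, `prod_pieceIdeals_eq_of_isRegular` — **`C = ⋂_Z 𝓘(Z) = Π_Z 𝓘(Z)`**, the
  factors being pairwise comaximal (`pieceIdeals_pairwise_sup_eq_top`);
* `isRegular_subscheme_vanishingIdeal_piece` — each piece `V(𝓘(Z)) = Z_red` is a regular scheme (its quotient stalks
  are those of `V(C)`: `stalkIdeal_centrePiece_eq`, `KollarNmPartBlowup.lean`), and `isIntegral_subscheme_vanishingIdeal_piece`
  — integral when `Z` is irreducible;
* `HasSNCWith.centrePiece` — simple normal crossings of a boundary with `C` pass to each piece;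
* `support_vanishingIdeal_piece_subset` — `Z ⊆ V(C)`.

Everything is standard (Stacks Tag 0357 / 033M: a normal — in particular a regular — locally Noetherian scheme with
finitely many irreducible components is the disjoint union of its integral irreducible components; BGMW §4 Step 2:
splitting a smooth divisor or centre into its components) over the tree's carriers; no definitions are introduced.
Written for the HIRONAKA-L discharge lane (cell res-hironaka; Γ-monomial case of Th. 16.4 / Rem. 16.2 (3), GAP row
R26 key 26b, route of res-type-001 2026-08-27T01:15:13Z, file «F2») by res-D-pv-052.

## References
* The Stacks Project, Tag 0357 (a normal scheme with finitely many irreducible components is a disjoint union of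
  normal integral schemes) and Tag 033M. [StacksProject]
* E. Bierstone, D. Grigoriev, P. Milman, J. Włodarczyk, *Effective Hironaka resolution and its complexity*,
  Asian J. Math. 15 (2011), arXiv:1206.3090, §4 Step 2 / 2b (p. 12–13). [BierstoneGrigorievMilmanWlodarczyk2011]
* J. Kollár, *Lectures on Resolution of Singularities*, Ann. of Math. Stud. 166 (2007), (3.111) Step 3. [Kollar2007]
-/

noncomputable section

open CategoryTheory AlgebraicGeometry TopologicalSpace IsLocalRing

namespace Literature.AlgebraicGeometry.Resolution

universe u

variable {X : Scheme.{u}}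

/-! ## The irreducible components of a regular centre partition it -/

section Components

variable [IsLocallyNoetherian X] [NoetherianSpace X] {C : X.IdealSheafData}

/-- **The irreducible components of a regular closed subscheme `V(C)` are pairwise disjoint and cover `V(C)`**: the
list `Kollar2007.boundaryPieces C` is a piece partition of `C` (regular local rings are domains, so every point lies on
exactly one component). [cite: StacksProject, Tag 0357] -/
theorem isPiecePartition_boundaryPieces_of_isRegular (hC : Scheme.IsRegular C.subscheme) :
    IsPiecePartition C (Kollar2007.boundaryPieces C) := by
  constructor
  · rw [List.pairwise_iff_getElem]
    intro i j hi hj hij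
    have hZi := Kollar2007.mem_boundaryPieces_iff.mp (List.getElem_mem hi)
    have hZj := Kollar2007.mem_boundaryPieces_iff.mp (List.getElem_mem hj)
    refine componentsIn_pairwiseDisjoint_of_isRegular_subscheme hC hZi hZj fun heq => ?_
    have hne := (Kollar2007.nodup_boundaryPieces C).getElem_inj_iff (hi := hi) (hj := hj) |>.not.mpr
      (Nat.ne_of_lt hij)
    exact hne (Closeds.ext heq)
  · ext x
    simp only [Set.mem_iUnion, exists_prop]
    constructor
    · rintro ⟨Z, hZ, hx⟩
      exact componentsIn.subset (Kollar2007.mem_boundaryPieces_iff.mp hZ) hx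
    · intro hx
      obtain ⟨E', hE', hxE'⟩ := componentsIn.exists_mem hx
      exact ⟨⟨E', componentsIn.isClosed C.support.isClosed hE'⟩, Kollar2007.mem_boundaryPieces_iff.mpr hE', hxE'⟩

omit [IsLocallyNoetherian X] in
/-- Each component of `V(C)` is irreducible (in particular non-empty). [cite: StacksProject, Tag 0357] -/
theorem isIrreducible_of_mem_boundaryPieces {Z : Closeds X} (hZ : Z ∈ Kollar2007.boundaryPieces C) :
    IsIrreducible (Z : Set X) :=
  componentsIn.isIrreducible (Kollar2007.mem_boundaryPieces_iff.mp hZ)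

omit [IsLocallyNoetherian X] in
/-- Each component of `V(C)` is non-empty. [cite: StacksProject, Tag 0357] -/
theorem nonempty_of_mem_boundaryPieces {Z : Closeds X} (hZ : Z ∈ Kollar2007.boundaryPieces C) :
    (Z : Set X).Nonempty :=
  (isIrreducible_of_mem_boundaryPieces hZ).nonempty

omit [IsLocallyNoetherian X] in
/-- `V(C)` has no components iff it is empty, i.e. iff `C = ⊤` (the empty centre, whose blow-up is an isomorphism).
[cite: StacksProject, Tag 0357] -/
theorem boundaryPieces_eq_nil_iff : Kollar2007.boundaryPieces C = [] ↔ C = ⊤ := by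
  constructor
  · intro h
    rw [← Scheme.IdealSheafData.support_eq_bot_iff]
    ext x
    simp only [Closeds.coe_bot, Set.mem_empty_iff_false, iff_false]
    intro hx
    obtain ⟨E', hE', -⟩ := componentsIn.exists_mem hx
    have hmem : (⟨E', componentsIn.isClosed C.support.isClosed hE'⟩ : Closeds X) ∈ Kollar2007.boundaryPieces C :=
      Kollar2007.mem_boundaryPieces_iff.mpr hE'
    rw [h] at hmem
    simp at hmem
  · rintro rfl
    exact Kollar2007.boundaryPieces_top

omit [IsLocallyNoetherian X] in
/-- The number of components of `V(C)` is the number of irreducible components of the closed set `V(C)`.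
[cite: StacksProject, Tag 0357] -/
theorem length_boundaryPieces : (Kollar2007.boundaryPieces C).length = (componentsIn (C.support : Set X)).ncard := by
  classical
  rw [← List.toFinset_card_of_nodup (Kollar2007.nodup_boundaryPieces C), ← Set.ncard_coe_finset]
  have hset : ((Kollar2007.boundaryPieces C).toFinset : Set (Closeds X)) =
      (fun Z : Closeds X => (Z : Set X)) ⁻¹' componentsIn (C.support : Set X) := by
    ext Z
    simp [Kollar2007.mem_boundaryPieces_iff]
  rw [hset]
  refine (Set.ncard_preimage_of_injective_subset_range (fun Z Z' h => Closeds.ext h) ?_)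
  intro E hE
  exact ⟨⟨E, componentsIn.isClosed C.support.isClosed hE⟩, rfl⟩

end Components

/-! ## The ideal of a regular centre is the product of the ideals of its pieces -/

section Pieces

variable {C : X.IdealSheafData}

/-- **`C = ⋂_Z 𝓘(Z)`** over any partition of the regular centre `V(C)` into closed pieces (`C` is radical:
`eq_vanishingIdeal_support_of_isRegular`). [cite: StacksProject, Tag 0357] -/
theorem iInf_pieceIdeals_eq_of_isRegular (hC : Scheme.IsRegular C.subscheme) {Zs : List (Closeds X)}
    (h : IsPiecePartition C Zs) : (⨅ Z ∈ Zs, Scheme.IdealSheafData.vanishingIdeal Z) = C := by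
  have h1 : (⨆ Z ∈ Zs, Z : Closeds X) = C.support := by
    refine le_antisymm (iSup₂_le fun Z hZ => ?_) fun x hx => ?_
    · exact h.subset hZ
    · obtain ⟨Z, hZ, hxZ⟩ := h.exists_mem hx
      exact (le_iSup₂ (f := fun (Z : Closeds X) (_ : Z ∈ Zs) => Z) Z hZ) hxZ
  rw [eq_vanishingIdeal_support_of_isRegular C hC, ← h1]
  simp only [Scheme.IdealSheafData.vanishingIdeal_iSup]

/-- The ideals of the pieces of a piece partition are pairwise comaximal (disjoint supports).
[cite: BierstoneGrigorievMilmanWlodarczyk2011, §4 Step 2 (p. 12)] -/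
theorem pieceIdeals_pairwise_sup_eq_top {Zs : List (Closeds X)} (h : IsPiecePartition C Zs) :
    (pieceIdeals Zs).Pairwise fun P Q => P ⊔ Q = ⊤ := by
  unfold pieceIdeals
  rw [List.pairwise_map]
  refine h.1.imp fun {Z Z'} hd => IdealSheafData.sup_eq_top_of_disjoint_support ?_
  rwa [coe_support_vanishingIdeal, coe_support_vanishingIdeal]

/-- The ideals of the pieces of a piece partition have pairwise disjoint supports.
[cite: BierstoneGrigorievMilmanWlodarczyk2011, §4 Step 2 (p. 12)] -/
theorem pieceIdeals_pairwise_disjoint_support {Zs : List (Closeds X)} (h : IsPiecePartition C Zs) :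
    (pieceIdeals Zs).Pairwise fun (P Q : X.IdealSheafData) => Disjoint (P.support : Set X) Q.support := by
  unfold pieceIdeals
  rw [List.pairwise_map]
  refine h.1.imp fun {Z Z'} hd => ?_
  rwa [coe_support_vanishingIdeal, coe_support_vanishingIdeal]

/-- **`C = Π_Z 𝓘(Z)`**: the ideal of a regular centre is the product of the (pairwise comaximal) ideals of the pieces of
any partition of `V(C)` into closed pieces — the input of Stacks 080A (`IsBlowup.comp`: blowing up `Π_Z 𝓘(Z)` is
blowing up the pieces one after the other). [cite: StacksProject, Tag 0357] -/
theorem prod_pieceIdeals_eq_of_isRegular (hC : Scheme.IsRegular C.subscheme) {Zs : List (Closeds X)}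
    (h : IsPiecePartition C Zs) : (pieceIdeals Zs).prod = C := by
  rw [IdealSheafData.prod_eq_iInf_of_pairwise_disjoint _ (pieceIdeals_pairwise_disjoint_support h),
    ← iInf_pieceIdeals_eq_of_isRegular hC h]
  refine le_antisymm (le_iInf₂ fun Z hZ => iInf₂_le _ (List.mem_map.mpr ⟨Z, hZ, rfl⟩)) (le_iInf₂ fun P hP => ?_)
  obtain ⟨Z, hZ, rfl⟩ := List.mem_map.mp hP
  exact iInf₂_le Z hZ

/-- A piece lies in the centre: `Z ⊆ V(C)`, i.e. `V(𝓘(Z)) ⊆ V(C)`. [cite: BierstoneGrigorievMilmanWlodarczyk2011, §4 Step 2 (p. 12)] -/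
theorem support_vanishingIdeal_piece_subset {Zs : List (Closeds X)} (h : IsPiecePartition C Zs) {Z : Closeds X}
    (hZ : Z ∈ Zs) : ((Scheme.IdealSheafData.vanishingIdeal Z).support : Set X) ⊆ C.support := by
  rw [coe_support_vanishingIdeal]
  exact h.subset hZ

/-- The product of the piece ideals lies in each piece ideal: `Π_Z 𝓘(Z) ≤ 𝓘(Z)` (so `C ≤ 𝓘(Z)` for a regular centre,
`prod_pieceIdeals_eq_of_isRegular`). [cite: BierstoneGrigorievMilmanWlodarczyk2011, §4 Step 2 (p. 12)] -/
theorem prod_pieceIdeals_le_of_mem {Zs : List (Closeds X)} {Z : Closeds X} (hZ : Z ∈ Zs) :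
    (pieceIdeals Zs).prod ≤ Scheme.IdealSheafData.vanishingIdeal Z :=
  IdealSheafData.prod_le_of_mem (List.mem_map.mpr ⟨Z, hZ, rfl⟩)

/-- Off a piece its ideal has the unit stalk. [cite: BierstoneGrigorievMilmanWlodarczyk2011, §4 Step 2 (p. 12)] -/
theorem stalkIdeal_vanishingIdeal_of_not_mem {Z : Closeds X} {x : X} (hx : x ∉ (Z : Set X)) :
    stalkIdeal (Scheme.IdealSheafData.vanishingIdeal Z) x = ⊤ := by
  apply stalkIdeal_eq_top_of_not_mem_support
  intro h'
  apply hx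
  have h'' : x ∈ ((Scheme.IdealSheafData.vanishingIdeal Z).support : Set X) := h'
  rwa [coe_support_vanishingIdeal] at h''

/-- **Each piece of a regular centre is a regular scheme** (with its reduced structure `V(𝓘(Z))`): its quotient
stalks `𝒪_{X,x}/𝓘(Z)_x = 𝒪_{X,x}/C_x`, `x ∈ Z`, are those of the regular `V(C)`.
[cite: StacksProject, Tag 0357] -/
theorem isRegular_subscheme_vanishingIdeal_piece [IsLocallyNoetherian X] (hC : Scheme.IsRegular C.subscheme) {Zs : List (Closeds X)}
    (h : IsPiecePartition C Zs) {Z : Closeds X} (hZ : Z ∈ Zs) :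
    Scheme.IsRegular (Scheme.IdealSheafData.vanishingIdeal Z).subscheme := by
  rw [Scheme.isRegular_subscheme_iff]
  intro x hx
  have hxZ : x ∈ (Z : Set X) := by rwa [← coe_support_vanishingIdeal Z]
  rw [stalkIdeal_centrePiece_eq hC h hZ hxZ]
  exact (Scheme.isRegular_subscheme_iff C).mp hC x (h.subset hZ hxZ)

/-- An irreducible piece is an integral scheme (with its reduced structure) — the tree's
`ComponentGluing.isIntegral_subscheme_vanishingIdeal`, re-exported next to its companions. [cite: StacksProject, Tag 0357] -/
theorem isIntegral_subscheme_vanishingIdeal_piece {Z : Closeds X} (hZ : IsIrreducible (Z : Set X)) :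
    IsIntegral (Scheme.IdealSheafData.vanishingIdeal Z).subscheme :=
  ComponentGluing.isIntegral_subscheme_vanishingIdeal Z hZ

/-- **Simple normal crossings with the centre pass to its pieces**: if the boundary `B` has simple normal crossings
with the regular centre `C`, it has simple normal crossings with (the ideal of) every piece of a partition of `V(C)`
(same adapted parameters; the piece has the stalk `C_x` at its points). [cite: BierstoneGrigorievMilmanWlodarczyk2011, Def. 3.1.3 (2)] -/
theorem HasSNCWith.centrePiece [IsLocallyNoetherian X] {B : List X.IdealSheafData} (hB : HasSNCWith B C) {Zs : List (Closeds X)}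
    (h : IsPiecePartition C Zs) {Z : Closeds X} (hZ : Z ∈ Zs) :
    HasSNCWith B (Scheme.IdealSheafData.vanishingIdeal Z) := by
  intro x
  obtain ⟨hreg, u, hu, hι, hcentre⟩ := hB x
  refine ⟨hreg, u, hu, hι, fun hx => ?_⟩
  have hxZ : x ∈ (Z : Set X) := by rwa [← coe_support_vanishingIdeal Z]
  obtain ⟨S, hS⟩ := hcentre (h.subset hZ hxZ)
  exact ⟨S, by rw [stalkIdeal_centrePiece_eq hB.isRegular_subscheme h hZ hxZ, hS]⟩

end Pieces

/-! ## Summary for the re-sequencing of a regular centre -/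

section Summary

variable [IsLocallyNoetherian X] [NoetherianSpace X] {C : X.IdealSheafData}

/-- **Decomposition of a regular centre** (the form consumed by the re-sequencing of one blow-up along `V(C)` into
blow-ups along its components): for `V(C)` regular on a locally Noetherian scheme with Noetherian underlying space
there is a finite list of pairwise disjoint, irreducible closed pieces covering `V(C)`, each a regular integral
closed subscheme (reduced structure), with `C = Π_Z 𝓘(Z)` and the factors pairwise comaximal.
[cite: StacksProject, Tag 0357] -/
theorem Scheme.IsRegular.exists_pieces (hC : Scheme.IsRegular C.subscheme) :
    ∃ Zs : List (Closeds X), IsPiecePartition C Zs ∧ Zs.Nodup ∧ (∀ Z ∈ Zs, IsIrreducible (Z : Set X)) ∧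
      (pieceIdeals Zs).prod = C ∧ ((pieceIdeals Zs).Pairwise fun P Q => P ⊔ Q = ⊤) ∧
      (∀ Z ∈ Zs, Scheme.IsRegular (Scheme.IdealSheafData.vanishingIdeal Z).subscheme) ∧
      ∀ Z ∈ Zs, IsIntegral (Scheme.IdealSheafData.vanishingIdeal Z).subscheme :=
  ⟨Kollar2007.boundaryPieces C, isPiecePartition_boundaryPieces_of_isRegular hC, Kollar2007.nodup_boundaryPieces C,
    fun _ hZ => isIrreducible_of_mem_boundaryPieces hZ,
    prod_pieceIdeals_eq_of_isRegular hC (isPiecePartition_boundaryPieces_of_isRegular hC),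
    pieceIdeals_pairwise_sup_eq_top (isPiecePartition_boundaryPieces_of_isRegular hC),
    fun _ hZ => isRegular_subscheme_vanishingIdeal_piece hC (isPiecePartition_boundaryPieces_of_isRegular hC) hZ,
    fun _ hZ => isIntegral_subscheme_vanishingIdeal_piece (isIrreducible_of_mem_boundaryPieces hZ)⟩

end Summary

end Literature.AlgebraicGeometry.Resolution

end
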